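import Summits.ResolutionOfSingularities.ResolutionOfSingularities.Theorems.TwistCutCells
import Summits.ResolutionOfSingularities.ResolutionOfSingularities.Theorems.MarkedTransferCampaignW46ExitTreeTransport
import Literature.AlgebraicGeometry.Resolution.MarkedIdealPointBlowup
import Literature.AlgebraicGeometry.Resolution.PointCentrePermissible
import HarnessLib

/-!
# TwistCutElimination — decomp-res node «TwistCut» rev3 (lens-6 g21), tree file 4/5 of the node

Content VERBATIM from the decomp-res lens-6 g21 rev3 node file `HOME/decomp-res-lens-6/g21/TwistCutFinal.lean` (sha
a36321ac, 1 327 l;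
HOME = run/shared/lean/pub/decomp-res; rc 0 · 0 sorry · standard axioms; nested prefixes `TwistCut.lean` facffb9d
(ll. 1–779, in the tree as
`TwistCutOperators` · `TwistCutLaw` · `TwistCutCells`) ⊂ `TwistCutElim.lean` 868dfb91 (§10–§11) ⊂ `TwistCutUSC.lean`
c2aec299 (§12) ⊂ this file
(§13) — machine diffs = pure insertions; earlier parts imported, not repeated): its §10–§13 ONLY, as two tree files.
 Critic: CRITIC-LEDGER rows 161
(rev1 MAP +1: the elimination induction) / 161a (rev2, 0·0 hygiene: `WildSplitFinite` from `OrderUSC`); landing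
orders INBOX :605 / :622, package
NODE-g21-rev3.md ca6f9cc7 §3 (`TwistCutElimination` §10–§12 + `TwistCutOrderUSC` §13; here §12 rides with §13 only
to respect the 400-line file cap).

## This file

§10 transports along ring isomorphisms (`map_diffIdeal_le`, off-centre invariance of `IsAbsContactAt` /
`DiffSplitAt` under stalk isos) and §11 THE
ELIMINATION OF SPLIT WILD POINTS (PROVED modulo the costume `BaseStable` and the finiteness of the split wild set):
`isDatum_transform_point` (THE TWIST
LAW at a point centre), `elimination_aux` (induction on `ncard`), **`wildSplitElimination_of_finite`** (the def
`WildPointElimination n` of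
`TwistCutCells` DISCHARGED modulo `BaseStable ∧ WildSplitFinite n`) and `e1TopNoAbs_iff_e1TopNonSplit_final`.
Cone-free.  Imports `TwistCutCells` +
Literature `MarkedIdealPointBlowup` / `PointCentrePermissible`.  [WRITER NOTE: the lens lemma `map_map_symm'`
restated the landed
`CampaignW46.map_map_symm_of_equiv` (gate `dedup.landed`, p800232) — copy dropped, its two uses cite that theorem by
name (import
`MarkedTransferCampaignW46ExitTreeTransport`); nothing else changed.]

[WRITER NOTE (decomp-res writer g9): one tree file (≤ 400 lines); namespace, universe, sections, section variables /
opens and every declaration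
exactly as in the lens.]

(Sources: EGAIV4 16.8.2, 16.8.8; Matsumura1987 §26, Thm 30.6; BGMW §3.1; CossartJannsenSaito2020 Def. 3.13, §4;
CossartPiltant2008 Prop. 4.2; CossartPiltant2019; GortzWedhorn2020 Prop. 13.91/13.96; Giraud1975;
Hironaka1970Additive; Liu2002 §8.1.)
-/

noncomputable section

open CategoryTheory AlgebraicGeometry TopologicalSpace IsLocalRing
open Literature.AlgebraicGeometry.Resolution

universe u

namespace Summit.ResolutionOfSingularities.ResolutionOfSingularities.Theorems.TwistCutClasses

section Transport2

variable {A B : Type*} [CommRing A] [CommRing B]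

/-! ## §10 Transports along ring isomorphisms (for the off-centre invariance in the elimination) -/

/-- `e(Diff^{≤m}_ℤ(J)) ⊆ Diff^{≤m}_ℤ(e(J))` for a ring isomorphism `e` (conjugate the operators). [folklore] -/
theorem map_diffIdeal_le (e : A ≃+* B) (m : ℕ) (J : Ideal A) :
    (diffIdeal ℤ m J).map e ≤ diffIdeal ℤ m (J.map e) := by
  unfold diffIdeal
  rw [Ideal.map_span]
  refine Ideal.span_le.mpr ?_
  rintro _ ⟨x, ⟨D, hD, f, hf, rfl⟩, rfl⟩
  refine Ideal.subset_span ⟨conj e D, IsDiffOpLE.conj e hD, e f, Ideal.mem_map_of_mem _ hf, ?_⟩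
  simp only [conj_apply, RingEquiv.symm_apply_apply]

/-- `mem_map_iff_of_equiv`: Auxiliary step of this node's calculus, VERBATIM from the lens file (see the module
docstring); the statement is its type. [folklore] -/
theorem mem_map_iff_of_equiv (e : A ≃+* B) (J : Ideal A) (a : A) : e a ∈ J.map e ↔ a ∈ J := by
  rw [← Ideal.comap_symm, Ideal.mem_comap]; simp

variable [IsLocalRing A] [IsLocalRing B]

/-- Ring-level ABSOLUTE-CONTACT predicate transported along a ring isomorphism (one direction; the other is `e.symm`).
[folklore] -/
theorem absContact_transport (e : A ≃+* B) (m : ℕ) {J : Ideal A}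
    (h : ∃ u ∈ diffIdeal ℤ m J, u ∈ maximalIdeal A ∧ u ∉ maximalIdeal A ^ 2) :
    ∃ u ∈ diffIdeal ℤ m (J.map e), u ∈ maximalIdeal B ∧ u ∉ maximalIdeal B ^ 2 := by
  obtain ⟨u, hu, hum, hum2⟩ := h
  refine ⟨e u, map_diffIdeal_le e m J (Ideal.mem_map_of_mem _ hu), ?_, ?_⟩
  · rw [← map_ringEquiv_maximalIdeal e]; exact Ideal.mem_map_of_mem _ hum
  · rw [← map_ringEquiv_maximalIdeal e, ← Ideal.map_pow, mem_map_iff_of_equiv]; exact hum2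

/-- The residue-field isomorphism of a ring isomorphism of local rings. [folklore] -/
def residueMapEquiv (e : A ≃+* B) : ResidueField A ≃+* ResidueField B :=
  Ideal.quotientEquiv (maximalIdeal A) (maximalIdeal B) e (map_ringEquiv_maximalIdeal e).symm

/-- `residueMapEquiv_residue`: Auxiliary step of this node's calculus, VERBATIM from the lens file (see the module
docstring); the statement is its type. [folklore] -/
@[simp] theorem residueMapEquiv_residue (e : A ≃+* B) (a : A) :
    residueMapEquiv e (residue A a) = residue B (e a) := rfl

/-- Ring-level SPLIT predicate (the body of `DiffSplitAt`) transported along a ring isomorphism. [folklore] -/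
theorem split_transport (e : A ≃+* B) (n : ℕ) {J : Ideal A}
    (h : ∃ (d : ℕ) (c : Fin d → A), (maximalIdeal A).spanFinrank = d ∧ Ideal.span (Set.range c) = maximalIdeal A ∧
      ∃ f ∈ J, ∃ (E : Finset (Fin d → ℕ)) (a : (Fin d → ℕ) → A),
        (∀ e ∈ E, ∑ j, e j = n) ∧ (∀ i, Pi.single i n ∈ E) ∧
        f - ∑ e ∈ E, a e * ∏ j, c j ^ e j ∈ maximalIdeal A ^ (n + 1) ∧
        ∀ i : Fin d, ∃ δ : ResidueField A →ₗ[ℤ] ResidueField A, IsDiffOpLE ℤ (n - 1) δ ∧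
          ∀ e' ∈ E, δ (residue A (a e')) = if e' = Pi.single i n then 1 else 0) :
    ∃ (d : ℕ) (c : Fin d → B), (maximalIdeal B).spanFinrank = d ∧ Ideal.span (Set.range c) = maximalIdeal B ∧
      ∃ f ∈ J.map e, ∃ (E : Finset (Fin d → ℕ)) (a : (Fin d → ℕ) → B),
        (∀ e ∈ E, ∑ j, e j = n) ∧ (∀ i, Pi.single i n ∈ E) ∧
        f - ∑ e ∈ E, a e * ∏ j, c j ^ e j ∈ maximalIdeal B ^ (n + 1) ∧
        ∀ i : Fin d, ∃ δ : ResidueField B →ₗ[ℤ] ResidueField B, IsDiffOpLE ℤ (n - 1) δ ∧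
          ∀ e' ∈ E, δ (residue B (a e')) = if e' = Pi.single i n then 1 else 0 := by
  obtain ⟨d, c, hd, hc, f, hfJ, E, a, hE, hEi, hfa, hsplit⟩ := h
  refine ⟨d, fun j => e (c j), ?_, ?_, e f, Ideal.mem_map_of_mem _ hfJ, E, fun x => e (a x), hE, hEi, ?_, ?_⟩
  · rw [← map_ringEquiv_maximalIdeal e, Ideal.spanFinrank_map_eq_of_ringEquiv, hd]
  · rw [← map_ringEquiv_maximalIdeal e, ← hc, Ideal.map_span, ← Set.range_comp]; rfl
  · have h1 : e (f - ∑ x ∈ E, a x * ∏ j, c j ^ x j) ∈ (maximalIdeal A ^ (n + 1)).map e :=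
      Ideal.mem_map_of_mem _ hfa
    rw [Ideal.map_pow, map_ringEquiv_maximalIdeal e] at h1
    simpa [map_sub, map_sum, map_mul, map_prod, map_pow] using h1
  · intro i
    obtain ⟨δ, hδ, hδE⟩ := hsplit i
    refine ⟨conj (residueMapEquiv e) δ, IsDiffOpLE.conj _ hδ, fun e' he' => ?_⟩
    rw [conj_apply, ← residueMapEquiv_residue, RingEquiv.symm_apply_apply, hδE e' he']
    split_ifs <;> simp

end Transport2

section Elimination

open Summit.ResolutionOfSingularities.ResolutionOfSingularities.Theorems
open WeakOrderReduction ForcedTowerClasses SubfieldContactClasses AbsoluteContactClasses PurityValveClasses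
open Scheme.IdealSheafData (vanishingIdeal)
variable {Y Y' : Scheme.{0}} {π : Y' ⟶ Y} {C : Y.IdealSheafData}

/-- Off the centre the stalk map is a ring isomorphism carrying `𝓘_{π y'}` to the stalk of the controlled transform.
[folklore; tree `IsBlowup.isIso_stalkMap_of_not_mem_support`, `IsBlowup.stalkIdeal_controlledTransform_of_not_mem`]
[folklore] -/
theorem exists_stalkEquiv_of_not_mem (hπ : IsBlowup π C) (I : Y.IdealSheafData) (b : ℕ) {y' : Y'}
    (hy : π.base y' ∉ (C.support : Set Y)) :
    ∃ e : Y.presheaf.stalk (π.base y') ≃+* Y'.presheaf.stalk y',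
      stalkIdeal (controlledTransform π C I b) y' = (stalkIdeal I (π.base y')).map e := by
  haveI := hπ.isIso_stalkMap_of_not_mem_support hy
  refine ⟨(asIso (π.stalkMap y')).commRingCatIsoToRingEquiv, ?_⟩
  rw [hπ.stalkIdeal_controlledTransform_of_not_mem I b hy, stalkIdeal_comap_eq_map_stalkMap]
  rfl

/-- OFF-CENTRE INVARIANCE of absolute stalk contact. [folklore] -/
theorem isAbsContactAt_transform_iff_of_not_mem (hπ : IsBlowup π C) (I : Y.IdealSheafData) (b n : ℕ) {y' : Y'}
    (hy : π.base y' ∉ (C.support : Set Y)) :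
    IsAbsContactAt (controlledTransform π C I b) n y' ↔ IsAbsContactAt I n (π.base y') := by
  obtain ⟨e, he⟩ := exists_stalkEquiv_of_not_mem hπ I b hy
  unfold IsAbsContactAt
  rw [he]
  refine ⟨fun h => ?_, fun h => absContact_transport e (n - 1) h⟩
  have h' := absContact_transport e.symm (n - 1) h
  rwa [Summit.ResolutionOfSingularities.ResolutionOfSingularities.Theorems.CampaignW46.map_map_symm_of_equiv] at h'

/-- OFF-CENTRE INVARIANCE of differential splitness. [folklore] -/
theorem diffSplitAt_transform_iff_of_not_mem (hπ : IsBlowup π C) (I : Y.IdealSheafData) (b n : ℕ) {y' : Y'}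
    (hy : π.base y' ∉ (C.support : Set Y)) :
    DiffSplitAt (controlledTransform π C I b) n y' ↔ DiffSplitAt I n (π.base y') := by
  obtain ⟨e, he⟩ := exists_stalkEquiv_of_not_mem hπ I b hy
  unfold DiffSplitAt
  rw [he]
  refine ⟨fun h => ?_, fun h => split_transport e n h⟩
  have h' := split_transport e.symm n h
  rwa [Summit.ResolutionOfSingularities.ResolutionOfSingularities.Theorems.CampaignW46.map_map_symm_of_equiv] at h'

/-- A blow-up is injective off its centre. [folklore; tree `IsBlowup.isIso_compl`] [folklore] -/
theorem injOn_of_isBlowup (hπ : IsBlowup π C) : Set.InjOn π.base (π.base ⁻¹' (C.support : Set Y)ᶜ) := by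
  intro y₁ h₁ y₂ h₂ heq
  let W₀ : Y.Opens := ⟨(C.support : Set Y)ᶜ, C.support.isClosed.isOpen_compl⟩
  haveI : IsIso (π ∣_ W₀) := hπ.isIso_compl
  have h₁' : y₁ ∈ π ⁻¹ᵁ W₀ := h₁
  have h₂' : y₂ ∈ π ⁻¹ᵁ W₀ := h₂
  have key : (π ∣_ W₀).base ⟨y₁, h₁'⟩ = (π ∣_ W₀).base ⟨y₂, h₂'⟩ := Subtype.ext (by
    rw [show ((π ∣_ W₀).base ⟨y₁, h₁'⟩).1 = π.base y₁ from morphismRestrict_base_coe π W₀ ⟨y₁, h₁'⟩,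
      show ((π ∣_ W₀).base ⟨y₂, h₂'⟩).1 = π.base y₂ from morphismRestrict_base_coe π W₀ ⟨y₂, h₂'⟩]
    exact heq)
  have hinj := (Scheme.homeoOfIso (asIso (π ∣_ W₀))).injective
  rw [Scheme.coe_homeoOfIso, asIso_hom] at hinj
  exact congrArg Subtype.val (hinj key)

/-- THE POINT STEP: blowing up a SPLIT closed top point keeps `IsDatum n` and leaves NO point of the support over it
(the twist law). [new] [folklore] -/
theorem isDatum_transform_point (hπ : IsBlowup π C) (hY : Scheme.IsRegular Y) {n : ℕ} (hn : 1 ≤ n)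
    {M : MarkedIdeal Y} (hM : IsDatum n M) {y₀ : Y} (hy₀c : IsClosed ({y₀} : Set Y))
    (hCsupp : (C.support : Set Y) = {y₀}) (hCreg : Scheme.IsRegular C.subscheme) (hs : DiffSplitAt M.ideal n y₀) :
    IsDatum n (M.transform π C) ∧ ∀ y' : Y', π.base y' = y₀ → y' ∉ (M.transform π C).support := by
  have hno : ∀ y' : Y', π.base y' = y₀ → y' ∉ (M.transform π C).support :=
    fun y' hy' => noNearPointOver_of_diffSplitAt hY hn M hM.1 hy₀c hs C Y' π hCsupp hCreg hπ y' hy'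
  refine ⟨⟨by rw [MarkedIdeal.transform_mult, hM.1], fun y' => ?_⟩, hno⟩
  by_cases hy' : π.base y' = y₀
  · have h1 : ¬ (((M.transform π C).mult : ℕ∞) ≤ idealOrder (M.transform π C).ideal y') := hno y' hy'
    rw [MarkedIdeal.transform_mult, hM.1] at h1
    exact le_of_lt (not_le.mp h1)
  · have hy'C : π.base y' ∉ (C.support : Set Y) := by rw [hCsupp]; exact hy'
    rw [MarkedIdeal.transform_ideal, hπ.idealOrder_controlledTransform_of_not_mem M.ideal M.mult hy'C]
    exact hM.2 _

/-- The WILD SET of a marked ideal at marking `n`: closed top points without absolute stalk contact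
(`TopNoAbsContact Y M.ideal n ↔ (wildSet M n).Nonempty`). DEFINITION (support). -/
def wildSet (M : MarkedIdeal Y) (n : ℕ) : Set Y :=
  {y | IsClosed ({y} : Set Y) ∧ idealOrder M.ideal y = ((n : ℕ) : ℕ∞) ∧ ¬ IsAbsContactAt M.ideal n y}

/-- `topNoAbsContact_iff_wildSet_nonempty`: Auxiliary step of this node's calculus, VERBATIM from the lens file (see
the module docstring); the statement is its type. [folklore] -/
theorem topNoAbsContact_iff_wildSet_nonempty (M : MarkedIdeal Y) (n : ℕ) :
    TopNoAbsContact Y M.ideal n ↔ (wildSet M n).Nonempty := Iff.rfl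

/-- After the point step, every wild point upstairs lies over a wild point downstairs OTHER than the centre, and is split
if that one is. [new] [folklore] -/
theorem wild_transform (hπ : IsBlowup π C) [IsLocallyNoetherian Y] (hY : Scheme.IsRegular Y) {n : ℕ} (hn : 1 ≤ n)
    {M : MarkedIdeal Y} (hM : IsDatum n M) {y₀ : Y} (hy₀c : IsClosed ({y₀} : Set Y))
    (hCsupp : (C.support : Set Y) = {y₀}) (hCreg : Scheme.IsRegular C.subscheme) (hs : DiffSplitAt M.ideal n y₀)
    {y' : Y'} (hw : y' ∈ wildSet (M.transform π C) n) :
    π.base y' ∉ (C.support : Set Y) ∧ π.base y' ∈ wildSet M n \ {y₀} ∧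
      (DiffSplitAt M.ideal n (π.base y') → DiffSplitAt (M.transform π C).ideal n y') := by
  obtain ⟨hcl, hord, hna⟩ := hw
  have hne : π.base y' ≠ y₀ := by
    intro h
    apply (isDatum_transform_point hπ hY hn hM hy₀c hCsupp hCreg hs).2 y' h
    show ((M.transform π C).mult : ℕ∞) ≤ idealOrder (M.transform π C).ideal y'
    rw [MarkedIdeal.transform_mult, hM.1, hord]
  have hy'C : π.base y' ∉ (C.support : Set Y) := by rw [hCsupp]; exact hne
  haveI := hπ.isProper
  refine ⟨hy'C, ⟨⟨?_, ?_, ?_⟩, hne⟩, fun hsp => ?_⟩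
  · have := π.isClosedMap _ hcl
    rwa [Set.image_singleton] at this
  · rw [← hπ.idealOrder_controlledTransform_of_not_mem M.ideal M.mult hy'C]; exact hord
  · rw [MarkedIdeal.transform_ideal, isAbsContactAt_transform_iff_of_not_mem hπ M.ideal M.mult n hy'C] at hna
    exact hna
  · rw [MarkedIdeal.transform_ideal, diffSplitAt_transform_iff_of_not_mem hπ M.ideal M.mult n hy'C]; exact hsp

/-- **THE ELIMINATION INDUCTION** (PROVED modulo the costume `BaseStable`): finitely many SPLIT wild closed top points are
removed by blowing them up one at a time; the result is again a base datum at marking `n` with EMPTY wild set. [new]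
[folklore] -/
theorem elimination_aux (hBS : BaseStable) {n : ℕ} (hn : 1 ≤ n) {k : Type} [Field k] :
    ∀ (N : ℕ) (Y : Scheme.{0}) (g : Y ⟶ Spec (.of k)), IsBase Y g → ∀ M : MarkedIdeal Y, IsDatum n M →
      (wildSet M n).Finite → (wildSet M n).ncard ≤ N → (∀ y ∈ wildSet M n, DiffSplitAt M.ideal n y) →
      ∃ t : CentreSeq Y, WeakAdmissible t M ∧ ∃ _ : IsBase t.top (t.comp ≫ g),
        IsDatum n (t.transformMarked M) ∧ wildSet (t.transformMarked M) n = ∅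
  | 0, Y, g, hB, M, hM, hfin, hcard, _ => by
    have hempty : wildSet M n = ∅ := (Set.ncard_eq_zero hfin).mp (Nat.le_zero.mp hcard)
    refine ⟨CentreSeq.nil Y, trivial, ?_, hM, hempty⟩
    show IsBase Y (𝟙 Y ≫ g)
    simpa using hB
  | N + 1, Y, g, hB, M, hM, hfin, hcard, hsplit => by
    by_cases hempty : wildSet M n = ∅
    · refine ⟨CentreSeq.nil Y, trivial, ?_, hM, hempty⟩
      show IsBase Y (𝟙 Y ≫ g)
      simpa using hB
    obtain ⟨y₀, hy₀⟩ := Set.nonempty_iff_ne_empty.mpr hempty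
    have hy₀c : IsClosed ({y₀} : Set Y) := hy₀.1
    haveI := hB.locallyOfFiniteType
    haveI : IsLocallyNoetherian Y := LocallyOfFiniteType.isLocallyNoetherian g
    -- the point centre
    have hCsupp : ((vanishingIdeal ⟨{y₀}, hy₀c⟩ : Y.IdealSheafData).support : Set Y) = {y₀} :=
      coe_support_vanishingIdeal_singleton hy₀c
    have hCreg : Scheme.IsRegular (vanishingIdeal ⟨{y₀}, hy₀c⟩ : Y.IdealSheafData).subscheme :=
      isRegular_subscheme_vanishingIdeal_singleton hy₀c
    have hCsub : ((vanishingIdeal ⟨{y₀}, hy₀c⟩ : Y.IdealSheafData).support : Set Y) ⊆ M.support := by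
      rw [hCsupp, Set.singleton_subset_iff]
      show (M.mult : ℕ∞) ≤ idealOrder M.ideal y₀
      rw [hM.1, hy₀.2.1]
    have hπ := blowup.isBlowup (vanishingIdeal ⟨{y₀}, hy₀c⟩ : Y.IdealSheafData)
    have hB₁ : IsBase (blowup (vanishingIdeal ⟨{y₀}, hy₀c⟩ : Y.IdealSheafData))
        (blowup.π (vanishingIdeal ⟨{y₀}, hy₀c⟩ : Y.IdealSheafData) ≫ g) := hBS k Y g hB _ hCreg
    have hs₀ : DiffSplitAt M.ideal n y₀ := hsplit y₀ hy₀
    obtain ⟨hM₁, -⟩ := isDatum_transform_point hπ hB.isRegular hn hM hy₀c hCsupp hCreg hs₀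
    have hwt := fun y' (hw : y' ∈ wildSet (M.transform (blowup.π (vanishingIdeal ⟨{y₀}, hy₀c⟩ : Y.IdealSheafData))
        (vanishingIdeal ⟨{y₀}, hy₀c⟩)) n) => wild_transform hπ hB.isRegular hn hM hy₀c hCsupp hCreg hs₀ hw
    have hinj : Set.InjOn (blowup.π (vanishingIdeal ⟨{y₀}, hy₀c⟩ : Y.IdealSheafData)).base
        (wildSet (M.transform (blowup.π (vanishingIdeal ⟨{y₀}, hy₀c⟩ : Y.IdealSheafData))
          (vanishingIdeal ⟨{y₀}, hy₀c⟩)) n) :=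
      (injOn_of_isBlowup hπ).mono fun y' hw => (hwt y' hw).1
    have hmaps : ∀ y' ∈ wildSet (M.transform (blowup.π (vanishingIdeal ⟨{y₀}, hy₀c⟩ : Y.IdealSheafData))
        (vanishingIdeal ⟨{y₀}, hy₀c⟩)) n,
        (blowup.π (vanishingIdeal ⟨{y₀}, hy₀c⟩ : Y.IdealSheafData)).base y' ∈ wildSet M n \ {y₀} :=
      fun y' hw => (hwt y' hw).2.1
    have hfin₀ : (wildSet M n \ {y₀}).Finite := hfin.sdiff
    have hfin₁ : (wildSet (M.transform (blowup.π (vanishingIdeal ⟨{y₀}, hy₀c⟩ : Y.IdealSheafData))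
        (vanishingIdeal ⟨{y₀}, hy₀c⟩)) n).Finite :=
      Set.Finite.of_finite_image (hfin₀.subset (Set.image_subset_iff.mpr fun y' hw => hmaps y' hw)) hinj
    have hcard₁ : (wildSet (M.transform (blowup.π (vanishingIdeal ⟨{y₀}, hy₀c⟩ : Y.IdealSheafData))
        (vanishingIdeal ⟨{y₀}, hy₀c⟩)) n).ncard ≤ N := by
      have h1 := Set.ncard_le_ncard_of_injOn _ hmaps hinj hfin₀
      rw [Set.ncard_sdiff_singleton_of_mem hy₀] at h1
      omega
    have hsplit₁ : ∀ y' ∈ wildSet (M.transform (blowup.π (vanishingIdeal ⟨{y₀}, hy₀c⟩ : Y.IdealSheafData))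
        (vanishingIdeal ⟨{y₀}, hy₀c⟩)) n, DiffSplitAt (M.transform (blowup.π (vanishingIdeal ⟨{y₀}, hy₀c⟩ :
          Y.IdealSheafData)) (vanishingIdeal ⟨{y₀}, hy₀c⟩)).ideal n y' :=
      fun y' hw => (hwt y' hw).2.2 (hsplit _ (hmaps y' hw).1)
    obtain ⟨t₁, hadm₁, hB₁', hM₁', hempty₁⟩ :=
      elimination_aux hBS hn N _ _ hB₁ _ hM₁ hfin₁ hcard₁ hsplit₁
    refine ⟨CentreSeq.cons _ t₁, ⟨hCsub, hCreg, hadm₁⟩, ?_, hM₁', hempty₁⟩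
    show IsBase _ ((t₁.comp ≫ blowup.π _) ≫ g)
    simpa [Category.assoc] using hB₁'

/-- **port · `WildSplitFinite n`** (KNOWN-MOD-PORT; the ONLY non-costume input left): a base datum at marking `n` all of whose
wild closed top points are split has FINITELY MANY wild closed top points.  Proof obligations (standard): upper
semicontinuity of the order (CossartPiltant2008 Prop. 4.2, tree `isClosed_setOf_le_idealOrder`); by the twist law and
properness of the point blow-up a split point is ISOLATED in the closed top locus; a noetherian space has finitely many
isolated points in a closed subset. -/
def WildSplitFinite (n : ℕ) : Prop :=
  ∀ (k : Type) [Field k] (Y : Scheme.{0}) (g : Y ⟶ Spec (.of k)), IsBase Y g → ∀ M : MarkedIdeal Y, IsDatum n M →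
    (∀ y ∈ wildSet M n, DiffSplitAt M.ideal n y) → (wildSet M n).Finite

/-- **port · `WildSplitElimination n`** — the elimination statement actually consumed by the decided chain (weaker than
`WildPointElimination n`: its hypothesis is the stalk-local split condition). PROVED below from `BaseStable` and
`WildSplitFinite n`. -/
def WildSplitElimination (n : ℕ) : Prop :=
  ∀ p : ℕ, p.Prime → ∀ (k : Type) [Field k] [CharP k p] (Y : Scheme.{0}) (g : Y ⟶ Spec (.of k)),
    IsBase Y g → ∀ M : MarkedIdeal Y, IsDatum n M →
      (∀ y : Y, IsClosed ({y} : Set Y) → idealOrder M.ideal y = ((n : ℕ) : ℕ∞) → ¬ IsAbsContactAt M.ideal n y →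
        DiffSplitAt M.ideal n y) →
      ∃ t : CentreSeq Y, WeakAdmissible t M ∧ ∃ _ : IsBase t.top (t.comp ≫ g),
        IsDatum n (t.transformMarked M) ∧ ¬ TopNoAbsContact t.top (t.transformMarked M).ideal n

/-- **`BaseStable → WildSplitFinite n → WildSplitElimination n`** (PROVED). [new] [folklore] -/
theorem wildSplitElimination_of_finite (hBS : BaseStable) {n : ℕ} (hn : 1 ≤ n) (hF : WildSplitFinite n) :
    WildSplitElimination n := by
  intro p _ k _ _ Y g hB M hM hsplit
  have hsplit' : ∀ y ∈ wildSet M n, DiffSplitAt M.ideal n y := fun y hy => hsplit y hy.1 hy.2.1 hy.2.2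
  obtain ⟨t, hadm, hB', hM', hempty⟩ :=
    elimination_aux hBS hn _ Y g hB M hM (hF k Y g hB M hM hsplit') le_rfl hsplit'
  refine ⟨t, hadm, hB', hM', ?_⟩
  rw [topNoAbsContact_iff_wildSet_nonempty, hempty]
  exact Set.not_nonempty_empty

/-- The NoNear-shaped port implies the split-shaped one (by the twist law). [new] [folklore] -/
theorem wildSplitElimination_of_wildPointElimination {n : ℕ} (hn : 1 ≤ n) (hW : WildPointElimination n) :
    WildSplitElimination n := by
  intro p hp k _ _ Y g hB M hM hsplit
  exact hW p hp k Y g hB M hM fun y hyc hord hna =>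
    noNearPointOver_of_diffSplitAt hB.isRegular hn M hM.1 hyc (hsplit y hyc hord hna)

/-- **THE DECIDED CELL from the split-shaped port** (PROVED): `WORAllAbs n → WildSplitElimination n →
WORTopOnlySplit n`. [new] [folklore] -/
theorem worTopOnlySplit_of_allAbs_of_splitElimination {n : ℕ} (hA : WORAllAbs n) (hW : WildSplitElimination n) :
    WORTopOnlySplit n := by
  intro p hp k _ _ Y g hB M hM _ hns
  obtain ⟨t, hadm, hB', hM', hno⟩ := hW p hp k Y g hB M hM fun y hyc hord hna => by
    by_contra h
    exact hns ⟨y, hyc, hord, hna, h⟩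
  obtain ⟨t', ht'⟩ := hA p hp k t.top (t.comp ≫ g) hB' (t.transformMarked M) hM' hno
  exact ⟨seqAppend t t', weakResolution_seqAppend t t' M hadm ht'⟩

/-- **THE DECIDED CELL modulo the costume `BaseStable`, the finiteness port and the tame side** (PROVED). [new] [folklore] -/
theorem worTopOnlySplit_of_baseStable_of_finite (hBS : BaseStable) {n : ℕ} (hn : 1 ≤ n) (hF : WildSplitFinite n)
    (hA : WORAllAbs n) : WORTopOnlySplit n :=
  worTopOnlySplit_of_allAbs_of_splitElimination hA (wildSplitElimination_of_finite hBS hn hF)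

/-- **THE RE-LOCATION, final form**: `BaseStable → (∀ n ≥ 1, WildSplitFinite n) → SubfieldContactAbs → E 5 →
(E1TopNoAbs ↔ E1TopNonSplit)`. [new] [folklore] -/
theorem e1TopNoAbs_iff_e1TopNonSplit_final (hBS : BaseStable) (hF : ∀ n : ℕ, 1 ≤ n → WildSplitFinite n)
    (hSC : SubfieldContactAbs) (h5 : E 5) : E1TopNoAbs ↔ E1TopNonSplit := by
  rw [e1TopNoAbs_iff_nonSplit_onlySplit]
  exact ⟨fun h => h.1, fun h => ⟨h, fun n hn =>
    worTopOnlySplit_of_baseStable_of_finite hBS hn (hF n hn) (worAllAbs_of_five hSC hn (h5 n hn))⟩⟩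

/-- **Summit edge, final form**: `E 1` from `BaseStable`, the finiteness port, the tame engine and the residual.
[new] [folklore] -/
theorem e_one_of_nonSplit_final (hBS : BaseStable) (hF : ∀ n : ℕ, 1 ≤ n → WildSplitFinite n)
    (hSC : SubfieldContactAbs) (h5 : E 5) (hR : E1TopNonSplit) : E 1 :=
  (e_one_iff_topNoAbs hSC h5).2 ((e1TopNoAbs_iff_e1TopNonSplit_final hBS hF hSC h5).2 hR)

end Elimination

end Summit.ResolutionOfSingularities.ResolutionOfSingularities.Theorems.TwistCutClasses
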